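import Summits.QuantumFields.YangMills.Theorems.LangevinControlUVFemtoCurvatureSkewnessCQualitativeForms
import Summits.QuantumFields.YangMills.Theorems.LangevinControlUVFemtoCurvatureSkewnessCMadicDescent
import Summits.QuantumFields.YangMills.Theorems.LangevinControlUVFemtoCurvatureSkewnessCTwoEndedAssembly

/-!
# Crux `FemtoCurvatureSkewnessC` (stmt-QuantumFields-16205), line `ratio-transport`: the descent from the QUALITATIVE transports (skeleton v4.2)

Lead `prover-line-stmt-QuantumFields-16205-c2-0` (line lead, cycle 3, 2026-08-16).  Second companion proof file of the vocabulary (E)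
`LangevinControlUVFemtoCurvatureSkewnessCRatioTransportDefsE.lean`.  Theorems only, no `sorry`, nothing posited.  Pure real analysis
(`madic_split`, `guard_of_dominated`, `skewRatioT_congr`, the intermediate value theorem); no property of `skewRatioT` is used.

* `ratioFloor_of_twoEndedQ` — **the descent in rate-free form**: fixed-torus anchors + two-ended cutoff transport along the `M`-adic chains of
  any continuous positive map dominated by `a₀` + volume MODULUS, large-aspect-ratio CAUCHY property and separation MODULUS in `a₀`'s femto
  boxes ⇒ a ratio floor in `a₀`'s femto boxes (same architecture as the landed `ratioFloor_of_twoEnded`, p126586; every move now costs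
  `u₀/8` by a qualitative transport: the relative box / separation changes of the rounding moves are `< 1/N₀`).
* `signedRigidity_of_enginesQ`, `femtoCurvatureSkewnessC_of_enginesQ` — **skeleton v4.2's assembly**:
  `CutoffEngineTE → VolumeEngineQ → SeparationEngineQ → Anchors → FemtoCurvatureSkewnessC` (the served crux BY NAME; output map = the
  hypothesis map).
* (v4.2 is a pure weakening of v4.1: `volumeEngineQ_of_volumeEngine`, `separationEngineQ_of_separationEngine`, `engineQ_of_enginesTE`;
  the composite `CutoffEngineTE → VolumeEngine → SeparationEngine → Anchors → crux` is the landed `femtoCurvatureSkewnessC_of_enginesTE`.)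
* `engineQ_iff`, `femtoCurvatureSkewnessC_of_engineQ`, `engineQ_of_enginesTE` — the merged promotable statement `RatioTransportEngineQ`
  is the conjunction of the three v4.2 engine stubs, and with the anchors it closes the crux.
-/

set_option autoImplicit false

noncomputable section

namespace Summit.QuantumFields.YangMills.Cruxes.FemtoCurvatureSkewnessC.RatioTransport

open MeasureTheory Filter Topology
open scoped BigOperators
open Literature.MathematicalPhysics.QuantumFieldTheory
open Summit.QuantumFields.YangMills.Theorems.FemtoCurvatureSkewness.Negative (TwoPointPackage SkewnessPackage)
open Summit.QuantumFields.YangMills.Cruxes.FemtoCurvatureSkewness.CouplingCubicResponse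
  (SignedRigidity skewnessPackage_of_signedRigidity)
open Summit.QuantumFields.YangMills.Theses.LangevinControlUV (FemtoCurvatureSkewnessC)
open Summit.QuantumFields.YangMills.Theorems.FemtoCurvatureSkewness (femtoCurvatureSkewnessC_iff)

/-! ## § Descent — the M-adic two-ended descent from the QUALITATIVE fixed-coupling transports -/

section Descent

variable {G : Type} [Group G] [TopologicalSpace G] [IsTopologicalGroup G] [CompactSpace G]
  [MeasurableSpace G] [BorelSpace G]

/-- **The descent in rate-free form**: fixed-torus anchors + the two-ended cutoff transport along the `M`-adic chains of ANY continuous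
positive map `a` dominated by `a₀` + the volume modulus, the large-aspect-ratio Cauchy property and the separation modulus in `a₀`'s femto
boxes ⇒ a ratio floor in `a₀`'s femto boxes.  Same architecture as the landed `ratioFloor_of_twoEnded` (p126586), every step now at tolerance
`u₀/8` by a qualitative transport: (S) `n ↦ M^k n₀` by the separation modulus (relative change `< 1/n₀ ≤ 1/N₀ ≤ η_s`), (V1)
`L ↦ M^k⌊L/M^k⌋` by the volume modulus (relative change `< 1/L₀ ≤ 1/(8N₀) ≤ η_v`), (V2) aspect ratio `↦ K₀` by the Cauchy property
(`K₀ := K(u₀/8)`), (C) ONE two-ended cutoff transport to the coarse point `(B, β', n₀)`, `a β' = M^k a β`, `β' ∈ [β_ref, β]` by the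
intermediate value theorem for `a`, (A) the uniform anchor on the finite family `1 ≤ n₀ < M N₀`, `8 n₀ ≤ B ≤ K₀ n₀`. -/
theorem ratioFloor_of_twoEndedQ (r : LatticeRep G) (a a₀ : ℝ → ℝ) {M : ℕ} (hM : 2 ≤ M)
    (hpos : ∀ β, 0 < a β) (hcont : Continuous a) (hpos₀ : ∀ β, 0 < a₀ β) (hdom : Dominated a a₀)
    (hA : FixedTorusAnchors r) (hc : CutoffTwoEnded r a M) (hvm : VolumeModulus r a₀) (hvc : VolumeCauchy r a₀)
    (hs : SeparationModulus r a₀) : RatioFloor r a₀ := by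
  obtain ⟨u₀, hu₀, hAev⟩ := hA
  obtain ⟨K, β₃, hK, hKβ⟩ := hdom
  have hε : 0 < u₀ / 8 := by positivity
  -- the four qualitative transports at tolerance `u₀/8`
  obtain ⟨βc, ℓc, N₁, hℓc, hN₁, hTE⟩ := hc (u₀ / 8) hε
  obtain ⟨βv, ℓv, ηv, hℓv, hηv, hvolm⟩ := hvm (u₀ / 8) hε
  obtain ⟨βw, ℓw, K₀, hℓw, hK₀8, hvolc⟩ := hvc (u₀ / 8) hε
  obtain ⟨βs, ℓs, ηs, hℓs, hηs, hsep⟩ := hs (u₀ / 8) hε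
  have hM1 : 1 < M := hM
  have hMpos : 0 < M := by omega
  -- `N₀`: the two-ended threshold and the two moduli (relative changes below `1/N₀`)
  obtain ⟨N₂, hN₂⟩ := exists_nat_ge (1 / ηv + 1 / ηs)
  obtain ⟨N₀, hN₀def⟩ : ∃ N₀ : ℕ, N₀ = max N₁ N₂ := ⟨_, rfl⟩
  have hN₀1 : 1 ≤ N₀ := hN₀def ▸ le_trans hN₁ (le_max_left _ _)
  have hN₁N₀ : N₁ ≤ N₀ := hN₀def ▸ le_max_left _ _
  have hN₂N₀ : (N₂ : ℝ) ≤ N₀ := by rw [hN₀def]; exact_mod_cast le_max_right N₁ N₂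
  have hηv' : 0 ≤ 1 / ηv := (div_pos one_pos hηv).le
  have hηs' : 0 ≤ 1 / ηs := (div_pos one_pos hηs).le
  have hηvN : 1 ≤ ηv * N₀ := by
    have h1 : 1 / ηv ≤ (N₀ : ℝ) := by linarith
    rw [div_le_iff₀ hηv] at h1
    linarith
  have hηsN : 1 ≤ ηs * N₀ := by
    have h1 : 1 / ηs ≤ (N₀ : ℝ) := by linarith
    rw [div_le_iff₀ hηs] at h1
    linarith
  have hK₀pos : (0 : ℝ) < K₀ := by exact_mod_cast (show 0 < K₀ by omega)
  -- anchor thresholds on the finite family `n₀ < M N₀`, `L₀ ≤ M K₀ N₀`, majorised by one coupling `βA`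
  have hT' : ∀ L₀ n₀ : ℕ, ∃ T : ℝ, ∀ β : ℝ, T ≤ β → 1 ≤ n₀ → 8 * n₀ ≤ L₀ →
      ∀ (_ : NeZero L₀), u₀ ≤ skewRatioT r L₀ β n₀ := by
    intro L₀ n₀
    by_cases h : 1 ≤ n₀ ∧ 8 * n₀ ≤ L₀
    · haveI : NeZero L₀ := ⟨by omega⟩
      obtain ⟨T, hT⟩ := Filter.eventually_atTop.1 (hAev L₀ n₀ h.1 h.2)
      exact ⟨T, fun β hβ _ _ _ => hT β hβ⟩
    · exact ⟨0, fun β _ h1 h8 _ => (h ⟨h1, h8⟩).elim⟩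
  choose T hT using hT'
  obtain ⟨βA, hβAdef⟩ : ∃ βA : ℝ,
      βA = ∑ n₀ ∈ Finset.range (M * N₀), ∑ L₀ ∈ Finset.range (M * K₀ * N₀ + 1), |T L₀ n₀| := ⟨_, rfl⟩
  have hTle : ∀ L₀ n₀ : ℕ, n₀ < M * N₀ → L₀ < M * K₀ * N₀ + 1 → T L₀ n₀ ≤ βA := by
    intro L₀ n₀ hn hL
    rw [hβAdef]
    calc T L₀ n₀ ≤ |T L₀ n₀| := le_abs_self _
      _ ≤ ∑ L₀' ∈ Finset.range (M * K₀ * N₀ + 1), |T L₀' n₀| :=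
          Finset.single_le_sum (f := fun L₀' => |T L₀' n₀|) (fun _ _ => abs_nonneg _) (Finset.mem_range.2 hL)
      _ ≤ ∑ n₀' ∈ Finset.range (M * N₀), ∑ L₀' ∈ Finset.range (M * K₀ * N₀ + 1), |T L₀' n₀'| :=
          Finset.single_le_sum (f := fun n₀' => ∑ L₀' ∈ Finset.range (M * K₀ * N₀ + 1), |T L₀' n₀'|)
            (fun _ _ => Finset.sum_nonneg fun _ _ => abs_nonneg _) (Finset.mem_range.2 hn)
  -- the reference coupling and the femto thresholds of the floor
  obtain ⟨βref, hβrefdef⟩ : ∃ βref : ℝ, βref = max βA (max βc (max βv (max βw (max βs β₃)))) := ⟨_, rfl⟩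
  have hβA : βA ≤ βref := by rw [hβrefdef]; simp only [le_max_iff, le_refl, true_or]
  have hβc : βc ≤ βref := by rw [hβrefdef]; simp only [le_max_iff, le_refl, true_or, or_true]
  have hβv : βv ≤ βref := by rw [hβrefdef]; simp only [le_max_iff, le_refl, true_or, or_true]
  have hβw : βw ≤ βref := by rw [hβrefdef]; simp only [le_max_iff, le_refl, true_or, or_true]
  have hβs : βs ≤ βref := by rw [hβrefdef]; simp only [le_max_iff, le_refl, true_or, or_true]
  have hβ₃ : β₃ ≤ βref := by rw [hβrefdef]; simp only [le_max_iff, le_refl, or_true]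
  obtain ⟨ℓ₁, hℓ₁def⟩ : ∃ ℓ₁ : ℝ, ℓ₁ = min (min (ℓc / K) (min (min ℓv ℓw) ℓs)) (8 * a βref / K) := ⟨_, rfl⟩
  have hℓ₁pos : 0 < ℓ₁ := by
    rw [hℓ₁def]
    exact lt_min (lt_min (div_pos hℓc hK) (lt_min (lt_min hℓv hℓw) hℓs)) (div_pos (by linarith [hpos βref]) hK)
  refine ⟨βref, ℓ₁, u₀ / 2, hℓ₁pos, by positivity, ?_⟩
  intro L _ β n hβ hL hn h8
  have hβ₃β : β₃ ≤ β := hβ₃.trans hβ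
  have hLc : (L : ℝ) * a β ≤ ℓc :=
    guard_of_dominated hK hKβ hβ₃β (hL.trans (by rw [hℓ₁def]; exact (min_le_left _ _).trans (min_le_left _ _)))
  have hLv : (L : ℝ) * a₀ β ≤ ℓv := hL.trans (by
    rw [hℓ₁def]; exact (min_le_left _ _).trans ((min_le_right _ _).trans ((min_le_left _ _).trans (min_le_left _ _))))
  have hLw : (L : ℝ) * a₀ β ≤ ℓw := hL.trans (by
    rw [hℓ₁def]; exact (min_le_left _ _).trans ((min_le_right _ _).trans ((min_le_left _ _).trans (min_le_right _ _))))
  have hLs : (L : ℝ) * a₀ β ≤ ℓs := hL.trans (by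
    rw [hℓ₁def]; exact (min_le_left _ _).trans ((min_le_right _ _).trans (min_le_right _ _)))
  have hL8a : (L : ℝ) * a β ≤ 8 * a βref :=
    guard_of_dominated hK hKβ hβ₃β (hL.trans (by rw [hℓ₁def]; exact min_le_right _ _))
  have haβ : 0 < a β := hpos β
  have ha₀β : 0 < a₀ β := hpos₀ β
  have hβcβ : βc ≤ β := hβc.trans hβ
  have hβvβ : βv ≤ β := hβv.trans hβ
  have hβwβ : βw ≤ β := hβw.trans hβ
  have hβsβ : βs ≤ β := hβs.trans hβ
  -- M-adic decomposition of the separation and of the box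
  obtain ⟨k, hkdef⟩ : ∃ k : ℕ, k = Nat.log M (n / N₀) := ⟨_, rfl⟩
  obtain ⟨n₀, hn₀def⟩ : ∃ n₀ : ℕ, n₀ = n / M ^ k := ⟨_, rfl⟩
  obtain ⟨hk_le_n, -, hn₀1, hn₀lt, hdich, hn'le, hnlt⟩ := madic_split hM hN₀1 hn hkdef hn₀def
  have h2k : 0 < M ^ k := Nat.pow_pos hMpos
  obtain ⟨L₀, hL₀def⟩ : ∃ L₀ : ℕ, L₀ = L / M ^ k := ⟨_, rfl⟩
  have hL₀8 : 8 * n₀ ≤ L₀ := by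
    rw [hL₀def]; apply (Nat.le_div_iff_mul_le h2k).2
    calc 8 * n₀ * M ^ k = 8 * (M ^ k * n₀) := by ring
      _ ≤ 8 * n := Nat.mul_le_mul_left 8 hn'le
      _ ≤ L := h8
  have hL'le : M ^ k * L₀ ≤ L := by rw [hL₀def]; exact Nat.mul_div_le L (M ^ k)
  have hLlt : L < M ^ k * L₀ + M ^ k := by
    rw [hL₀def]
    have := Nat.lt_div_mul_add (a := L) h2k
    linarith [Nat.mul_comm (L / M ^ k) (M ^ k)]
  have hL₀pos : 0 < L₀ := by omega
  haveI hinstL' : NeZero (M ^ k * L₀) := ⟨(Nat.mul_pos h2k hL₀pos).ne'⟩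
  obtain ⟨d, hd⟩ := Nat.exists_eq_add_of_le hn'le
  have hd_lt : d < M ^ k := by omega
  have hn'pos : 0 < M ^ k * n₀ := Nat.mul_pos h2k (by omega)
  -- (S) separation modulus: `M^k n₀ ↦ M^k n₀ + d` at fixed `(L, β)`, relative change `< 1/n₀ ≤ 1/N₀ ≤ η_s`
  have hS : |skewRatioT r L β (M ^ k * n₀ + d) - skewRatioT r L β (M ^ k * n₀)| ≤ u₀ / 8 := by
    rcases hdich with hk0 | hNn
    · subst hk0
      have hd0 : d = 0 := by
        have : d < M ^ 0 := hd_lt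
        simpa using this
      subst hd0
      rw [Nat.add_zero, sub_self, abs_zero]; positivity
    · refine hsep L β (M ^ k * n₀) (M ^ k * n₀ + d) hβsβ hLs hn'pos (Nat.le_add_right _ _) ?_ (by rw [← hd]; exact h8)
      have h1 : (d : ℝ) ≤ (M : ℝ) ^ k := by exact_mod_cast hd_lt.le
      have h2 : (1 : ℝ) ≤ ηs * n₀ :=
        hηsN.trans (mul_le_mul_of_nonneg_left (by exact_mod_cast hNn) hηs.le)
      have h3 : (M : ℝ) ^ k ≤ ηs * ((M : ℝ) ^ k * n₀) := by
        calc (M : ℝ) ^ k = (M : ℝ) ^ k * 1 := (mul_one _).symm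
          _ ≤ (M : ℝ) ^ k * (ηs * n₀) := mul_le_mul_of_nonneg_left h2 (by positivity)
          _ = ηs * ((M : ℝ) ^ k * n₀) := by ring
      rw [add_mul, one_mul]
      push_cast
      linarith
  -- (V1) volume modulus: `L ↦ M^k ⌊L/M^k⌋` at fixed `(β, M^k n₀)`, relative change `< 1/L₀ ≤ 1/(8 n₀) ≤ η_v`
  have hV1 : |skewRatioT r L β (M ^ k * n₀) - skewRatioT r (M ^ k * L₀) β (M ^ k * n₀)| ≤ u₀ / 8 := by
    rcases hdich with hk0 | hNn
    · subst hk0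
      have hLL : L = M ^ 0 * L₀ := by simp [hL₀def]
      rw [skewRatioT_congr r hLL (rfl : β = β) (rfl : M ^ 0 * n₀ = M ^ 0 * n₀), sub_self, abs_zero]
      positivity
    · refine hvolm L (M ^ k * L₀) β (M ^ k * n₀) hβvβ hLv hn'pos ?_ hL'le ?_
      · calc 8 * (M ^ k * n₀) = M ^ k * (8 * n₀) := by ring
          _ ≤ M ^ k * L₀ := Nat.mul_le_mul_left _ hL₀8
      · have h1 : (L : ℝ) ≤ ((M ^ k * L₀ : ℕ) : ℝ) + (M : ℝ) ^ k := by exact_mod_cast hLlt.le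
        have h2 : (1 : ℝ) ≤ ηv * L₀ :=
          hηvN.trans (mul_le_mul_of_nonneg_left (by exact_mod_cast hNn.trans (by omega : n₀ ≤ L₀)) hηv.le)
        have h3 : (M : ℝ) ^ k ≤ ηv * ((M : ℝ) ^ k * L₀) := by
          calc (M : ℝ) ^ k = (M : ℝ) ^ k * 1 := (mul_one _).symm
            _ ≤ (M : ℝ) ^ k * (ηv * L₀) := mul_le_mul_of_nonneg_left h2 (by positivity)
            _ = ηv * ((M : ℝ) ^ k * L₀) := by ring
        rw [add_mul, one_mul]
        push_cast at h1 ⊢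
        linarith
  -- (V2) aspect ratio: `M^k L₀ ↦ M^k B` with `B := min L₀ (K₀ n₀)`, by the large-aspect-ratio Cauchy property
  obtain ⟨B, hB8, hBK, hBL₀, hV2⟩ : ∃ B : ℕ, 8 * n₀ ≤ B ∧ B ≤ K₀ * n₀ ∧ B ≤ L₀ ∧
      ∀ (i₂ : NeZero (M ^ k * B)),
        |skewRatioT r (M ^ k * L₀) β (M ^ k * n₀) - skewRatioT r (M ^ k * B) β (M ^ k * n₀)| ≤ u₀ / 8 := by
    by_cases hcase : L₀ ≤ K₀ * n₀
    · refine ⟨L₀, hL₀8, hcase, le_rfl, fun i₂ => ?_⟩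
      rw [sub_self, abs_zero]; positivity
    · have hlt : K₀ * n₀ < L₀ := not_le.1 hcase
      have hBpos : 0 < K₀ * n₀ := Nat.mul_pos (by omega) (by omega)
      refine ⟨K₀ * n₀, Nat.mul_le_mul_right _ hK₀8, le_rfl, hlt.le, fun i₂ => ?_⟩
      have hfem : ((M ^ k * L₀ : ℕ) : ℝ) * a₀ β ≤ ℓw :=
        le_trans (mul_le_mul_of_nonneg_right (by exact_mod_cast hL'le) ha₀β.le) hLw
      exact hvolc (M ^ k * L₀) (M ^ k * (K₀ * n₀)) β (M ^ k * n₀) hβwβ hfem hn'pos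
        (le_of_eq (by ring)) (Nat.mul_le_mul_left _ hlt.le)
  have hBpos : 0 < B := by omega
  haveI hinstBk : NeZero (M ^ k * B) := ⟨(Nat.mul_pos h2k hBpos).ne'⟩
  haveI hinstB : NeZero B := ⟨hBpos.ne'⟩
  -- (C) the coarse coupling by the intermediate value theorem, for the DOMINATED map `a` (and `β' = β` when `k = 0`)
  obtain ⟨β', hβ'ref, hβ'le, haβ', hβ'k⟩ : ∃ b : ℝ, βref ≤ b ∧ b ≤ β ∧ a b = (M : ℝ) ^ k * a β ∧ (k = 0 → b = β) := by
    by_cases hk : k = 0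
    · exact ⟨β, hβ, le_rfl, by rw [hk, pow_zero, one_mul], fun _ => rfl⟩
    · have hlow : a β ≤ (M : ℝ) ^ k * a β :=
        le_mul_of_one_le_left haβ.le (one_le_pow₀ (by exact_mod_cast hM1.le))
      have hup : (M : ℝ) ^ k * a β ≤ a βref := by
        have h2 : (M : ℝ) ^ k ≤ n := by exact_mod_cast hk_le_n
        have h3 : (8 : ℝ) * n ≤ L := by exact_mod_cast h8
        have h4 : 8 * (n : ℝ) * a β ≤ L * a β := mul_le_mul_of_nonneg_right h3 haβ.le
        calc (M : ℝ) ^ k * a β ≤ n * a β := mul_le_mul_of_nonneg_right h2 haβ.le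
          _ ≤ a βref := by nlinarith [h4, hL8a]
      obtain ⟨b, ⟨hb1, hb2⟩, hab⟩ :=
        intermediate_value_Icc' hβ hcont.continuousOn ⟨hlow, hup⟩
      exact ⟨b, hb1, hb2, hab, fun h => (hk h).elim⟩
  have f4 : skewRatioT r B β' n₀ - skewRatioT r (M ^ k * B) β (M ^ k * n₀) ≤ u₀ / 8 := by
    rcases hdich with hk0 | hNn
    · have hb : β' = β := hβ'k hk0
      subst hk0
      rw [hb]
      have e : skewRatioT r (M ^ 0 * B) β (M ^ 0 * n₀) = skewRatioT r B β n₀ :=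
        skewRatioT_congr r (by rw [pow_zero, one_mul]) rfl (by rw [pow_zero, one_mul])
      rw [e, sub_self]; positivity
    · have hfemto : ((M ^ k * B : ℕ) : ℝ) * a β ≤ ℓc := by
        have h1 : ((M ^ k * B : ℕ) : ℝ) ≤ L := by exact_mod_cast (Nat.mul_le_mul_left _ hBL₀).trans hL'le
        calc ((M ^ k * B : ℕ) : ℝ) * a β ≤ L * a β := by gcongr
          _ ≤ ℓc := hLc
      have h := hTE (M ^ k * B) B k n₀ β β' rfl (hN₁N₀.trans hNn) hB8 (hβc.trans hβ'ref) hβ'le hfemto haβ'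
      exact (abs_sub_le_iff.1 h).2
  -- (A) the anchor at `(B, β', n₀)`
  have f5 : u₀ ≤ skewRatioT r B β' n₀ := by
    have h4 : B < M * K₀ * N₀ + 1 := by
      have h4' : B ≤ M * K₀ * N₀ := by
        calc B ≤ K₀ * n₀ := hBK
          _ ≤ K₀ * (M * N₀) := Nat.mul_le_mul_left K₀ hn₀lt.le
          _ = M * K₀ * N₀ := by ring
      exact Nat.lt_succ_of_le h4'
    exact hT B n₀ β' ((hTle _ _ hn₀lt h4).trans (hβA.trans hβ'ref)) hn₀1 hB8 inferInstance
  -- assemble: four moves of `u₀/8` below the anchor `u₀`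
  have f1 : skewRatioT r L β (M ^ k * n₀) - skewRatioT r L β (M ^ k * n₀ + d) ≤ u₀ / 8 :=
    (abs_sub_le_iff.1 hS).2
  have f2 : skewRatioT r (M ^ k * L₀) β (M ^ k * n₀) - skewRatioT r L β (M ^ k * n₀) ≤ u₀ / 8 :=
    (abs_sub_le_iff.1 hV1).2
  have f3 : skewRatioT r (M ^ k * B) β (M ^ k * n₀) - skewRatioT r (M ^ k * L₀) β (M ^ k * n₀) ≤ u₀ / 8 :=
    (abs_sub_le_iff.1 (hV2 inferInstance)).2
  have lb : ∀ {x y l c : ℝ}, y - x ≤ c → l ≤ y → l - c ≤ x := fun h1 h2 => by linarith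
  have g1 : u₀ - u₀ / 8 - u₀ / 8 - u₀ / 8 - u₀ / 8 ≤ skewRatioT r L β (M ^ k * n₀ + d) :=
    lb f1 (lb f2 (lb f3 (lb f4 f5)))
  have hfinal : u₀ / 2 ≤ u₀ - u₀ / 8 - u₀ / 8 - u₀ / 8 - u₀ / 8 := by linarith
  rw [hd]
  exact hfinal.trans g1

end Descent

/-! ## § Assembly — skeleton v4.2 closes the served crux modulo E_c (two-ended), E_v (qualitative), E_s (qualitative) and A -/

/-- **Signed rigidity in the femto boxes of the hypothesis map** from the two-ended cutoff engine, the qualitative volume and separation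
engines and the anchors (floor by `ratioFloor_of_twoEndedQ`, rigidity by `a₀`'s own package). -/
theorem signedRigidity_of_enginesQ {G : Type} [Group G] [TopologicalSpace G] [IsTopologicalGroup G] [CompactSpace G]
    [MeasurableSpace G] [BorelSpace G] (hG : IsCompactSimpleLieGroup G) (hc : CutoffEngineTE) (hv : VolumeEngineQ)
    (hs : SeparationEngineQ) (r : LatticeRep G) (hA : FixedTorusAnchors r) {a₀ : ℝ → ℝ} (ha₀ : Continuous a₀)
    (hP₀ : TwoPointPackage r a₀) : SignedRigidity r a₀ := by
  obtain ⟨M, hM, a, ha, hpos, hdom, hcut⟩ := hc G hG r a₀ ha₀ hP₀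
  obtain ⟨Γ, β₀, ℓ₀, c, C, -, -, hpos₀, -, -⟩ := id hP₀
  obtain ⟨hvm, hvc⟩ := hv G hG r a₀ ha₀ hP₀
  exact signedRigidity_of_ratioFloor r hP₀
    (ratioFloor_of_twoEndedQ r a a₀ hM hpos ha hpos₀ hdom hA hcut hvm hvc (hs G hG r a₀ ha₀ hP₀))

/-- **Skeleton v4.2's composition: the line `ratio-transport` closes the served crux BY NAME modulo exactly E_c (two-ended), E_v
(qualitative), E_s (qualitative) and A** (CONDITIONAL on the four route-posited stubs; nothing asserted).  Output map = the hypothesis map. -/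
theorem femtoCurvatureSkewnessC_of_enginesQ (hc : CutoffEngineTE) (hv : VolumeEngineQ) (hs : SeparationEngineQ) (hA : Anchors) :
    FemtoCurvatureSkewnessC := by
  rw [femtoCurvatureSkewnessC_iff]
  intro G _ _ _ _ hG
  letI : MeasurableSpace G := borel G
  haveI : BorelSpace G := ⟨rfl⟩
  intro r hex
  obtain ⟨a₀, ha₀, hP₀⟩ := hex
  exact ⟨a₀, ha₀, hP₀, skewnessPackage_of_signedRigidity r hP₀
    (signedRigidity_of_enginesQ hG hc hv hs r (hA G hG r ⟨a₀, ha₀, hP₀⟩) ha₀ hP₀)⟩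

/-- The merged engine statement is the conjunction of the three v4.2 engine stubs. -/
theorem engineQ_iff : RatioTransportEngineQ ↔ CutoffEngineTE ∧ VolumeEngineQ ∧ SeparationEngineQ := by
  constructor
  · intro h
    exact ⟨fun G _ _ _ _ _ _ hG r a₀ ha₀ hP₀ => (h G hG r a₀ ha₀ hP₀).1,
      fun G _ _ _ _ _ _ hG r a₀ ha₀ hP₀ => (h G hG r a₀ ha₀ hP₀).2.1,
      fun G _ _ _ _ _ _ hG r a₀ ha₀ hP₀ => (h G hG r a₀ ha₀ hP₀).2.2⟩
  · rintro ⟨hc, hv, hs⟩ G _ _ _ _ _ _ hG r a₀ ha₀ hP₀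
    exact ⟨hc G hG r a₀ ha₀ hP₀, hv G hG r a₀ ha₀ hP₀, hs G hG r a₀ ha₀ hP₀⟩

/-- **ONE physics statement besides the anchors**: the merged engine statement and the anchors close the served crux BY NAME. -/
theorem femtoCurvatureSkewnessC_of_engineQ (hE : RatioTransportEngineQ) (hA : Anchors) : FemtoCurvatureSkewnessC := by
  obtain ⟨hc, hv, hs⟩ := engineQ_iff.1 hE
  exact femtoCurvatureSkewnessC_of_enginesQ hc hv hs hA

/-- The v4.1 engine stubs imply the merged engine statement. -/
theorem engineQ_of_enginesTE (hc : CutoffEngineTE) (hv : VolumeEngine) (hs : SeparationEngine) : RatioTransportEngineQ :=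
  engineQ_iff.2 ⟨hc, volumeEngineQ_of_volumeEngine hv, separationEngineQ_of_separationEngine hs⟩

end Summit.QuantumFields.YangMills.Cruxes.FemtoCurvatureSkewnessC.RatioTransport

end
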